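import Summits.CriticalPhenomena.PercolationContinuityZ3.Theorems.PercNearOneGluingNoHeavyConstsConditionedMarker
import Summits.CriticalPhenomena.PercolationContinuityZ3.Theorems.PercNearOneGluingNoHeavyConstsMDLXJointMarkerLattice
import HarnessLib

/-!
# MDL(X)′ for every functional saturated on the event `{s ↔ z}` (PAPER-2 track (ii): constants of the CSH family; seat `prim-consts-2`, gen 17)

builds on p205010 (kernel theorem, internal audit signed; external expert review pending).  Support file (`--supports
stmt-CriticalPhenomena-4575`); memo `run/shared/lean/prim/consts/FROM-prim-consts-2-g17-CYLINDER-DUALITY.md` §2.  Companion of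
`…ConstsMDLXJointReachPinned.lean` (functionals supported on `{s↔z}`).  No definitions, no named facts, no sorries; standard axioms.

Notation (as in `…ConstsMDLXJoint.lean`): owner `s`, avoided set `X`, markers `y`, `z`; `D = {s ↮ X}`, `T = {y ↮ {s}∪X} ∩ D`, `W = {y ↔ z}`,
`Y = {s ↔ y}`, `Z = {s ↔ z}`, `ν = μ(·|D)`, `p' = μ(T∩W)/μ(T)`.

* KEY INEQUALITY (in the tree: `Consts.mdlx_marker_reach_le`, gen 9): `μ(T∩W)·μ(D∩Y) ≤ μ(T)·μ(D∩Z)`, i.e. `p'·ν(s↔y) ≤ ν(s↔z)`.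
* `Consts.mdlxJoint_of_eq_on_reach` — **THEOREM: the `Consts.MDLXJoint` inequality holds, in every finite weighted graph, at every monotone `F` that is
  constant ON `{z ∈ V(C_s)}`** (`F(C) = M` whenever `z = s` or some pair of `C` contains `z`; e.g. the indicators of the up-events `U ⊇ {s↔z}` such as
  `{s↔z} ∪ {s↔b}`, `{s↔z} ∪ {C₀ ⊆ C_s}`).  Proof: `G = M − F ≥ 0` vanishes on `{s↔z}`, so with `J = ∫_D G` the margin is at least
  `J·[μ(T)μ(D∩Z) − μ(T∩W)μ(D∩Y)] ≥ 0`.  Together with `Consts.mdlxJoint_of_eq_off_reach` (constant OFF `{s↔z}`) and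
  `Consts.mdlxJoint_of_lowerMarker_le` ⊇ `{U ⊇ Y}` (gen 16) three of the four "pinned quadrants" `U ⊆ Z`, `U ⊇ Z`, `U ⊇ Y`, `U ⊆ Y` of up-events are
  proved; `U ⊆ Y` (up-events implying `s↔y`, e.g. `{s↔y}∩{s↔b}`) remains open beyond the marker lattice.
* `Consts.mdlxJoint_reachUnion` — the instance `F = max(1{s↔z}, 1{s↔b})` (up-event `{s↔z} ∪ {s↔b}`), every `b`.
[cite: VandenbergHaggstromKahn2005, Thm. 1.3 (p. 6), Thm. 1.4 (p. 7) with Remark 1 after Thm. 1.2 (p. 5)]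
-/

noncomputable section

namespace Summit.CriticalPhenomena.PercolationContinuityZ3.Theorems

open MeasureTheory Set Literature.Probability.LatticeModels Literature.Probability.Percolation
open scoped Classical

namespace Consts

variable {V : Type*} [Fintype V]

/-- **MDL(X)′ AT EVERY FUNCTIONAL SATURATED ON `{s ↔ z}`.**  For all weights, owner `s`, avoided set `X`, markers `y`, `z`, every `M : ℝ` and
every monotone functional `F` of the open edge cluster of `s` with `F(C) = M` whenever `z = s` or some pair of `C` contains `z`, the
`Consts.MDLXJoint` inequality holds:
`μ(T∩W)·[μ(D)∫_{D∩Y}F(C_s) − (∫_D F(C_s))μ(D∩Y)] ≤ μ(T)·[μ(D)∫_{D∩Z}F(C_s) − (∫_D F(C_s))μ(D∩Z)]`.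
[cite: VandenbergHaggstromKahn2005, Thm. 1.3 (p. 6), Thm. 1.4 (p. 7) with Remark 1 after Thm. 1.2 (p. 5)] -/
theorem mdlxJoint_of_eq_on_reach (w : Sym2 V → unitInterval) (s y z : V) (X : Set V)
    (F : Set (Sym2 V) → ℝ) (hF : Monotone F) (M : ℝ)
    (hFz : ∀ C : Set (Sym2 V), (z = s ∨ ∃ e ∈ C, z ∈ e) → F C = M) :
    (prodBernoulli w).real ({ω : BondConfig V | ∀ x ∈ insert s X, ¬ (openGraph ω).Reachable y x} ∩
          {ω | ∀ x ∈ X, ¬ (openGraph ω).Reachable s x} ∩ openConn y z) *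
        ((prodBernoulli w).real {ω : BondConfig V | ∀ x ∈ X, ¬ (openGraph ω).Reachable s x} *
            (∫ ω in {ω : BondConfig V | ∀ x ∈ X, ¬ (openGraph ω).Reachable s x} ∩ openConn s y,
              F (openEdgeCluster ω s) ∂(prodBernoulli w)) -
          (∫ ω in {ω : BondConfig V | ∀ x ∈ X, ¬ (openGraph ω).Reachable s x},
              F (openEdgeCluster ω s) ∂(prodBernoulli w)) *
            (prodBernoulli w).real ({ω : BondConfig V | ∀ x ∈ X, ¬ (openGraph ω).Reachable s x} ∩ openConn s y)) ≤
      (prodBernoulli w).real ({ω : BondConfig V | ∀ x ∈ insert s X, ¬ (openGraph ω).Reachable y x} ∩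
          {ω | ∀ x ∈ X, ¬ (openGraph ω).Reachable s x}) *
        ((prodBernoulli w).real {ω : BondConfig V | ∀ x ∈ X, ¬ (openGraph ω).Reachable s x} *
            (∫ ω in {ω : BondConfig V | ∀ x ∈ X, ¬ (openGraph ω).Reachable s x} ∩ openConn s z,
              F (openEdgeCluster ω s) ∂(prodBernoulli w)) -
          (∫ ω in {ω : BondConfig V | ∀ x ∈ X, ¬ (openGraph ω).Reachable s x},
              F (openEdgeCluster ω s) ∂(prodBernoulli w)) *
            (prodBernoulli w).real ({ω : BondConfig V | ∀ x ∈ X, ¬ (openGraph ω).Reachable s x} ∩ openConn s z)) := by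
  classical
  set μ := prodBernoulli w with hμ
  have hmeas : ∀ S : Set (BondConfig V), MeasurableSet S := fun _ => MeasurableSet.of_discrete
  set D : Set (BondConfig V) := {ω | ∀ x ∈ X, ¬ (openGraph ω).Reachable s x} with hD
  set TW : Set (BondConfig V) := {ω : BondConfig V | ∀ x ∈ insert s X, ¬ (openGraph ω).Reachable y x} ∩ D ∩ openConn y z
    with hTW
  set T : Set (BondConfig V) := {ω : BondConfig V | ∀ x ∈ insert s X, ¬ (openGraph ω).Reachable y x} ∩ D with hT
  set Yv : Set (BondConfig V) := openConn s y with hYv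
  set Zv : Set (BondConfig V) := openConn s z with hZv
  set f : BondConfig V → ℝ := fun ω => F (openEdgeCluster ω s) with hf
  set g : BondConfig V → ℝ := fun ω => M - f ω with hg
  -- `F ≤ M` everywhere: add a pair containing `z`
  have hFle : ∀ C : Set (Sym2 V), F C ≤ M := by
    intro C
    have h1 : F C ≤ F (C ∪ {s(z, z)}) := hF subset_union_left
    have h2 : F (C ∪ {s(z, z)}) = M := hFz _ (Or.inr ⟨s(z, z), mem_union_right C rfl, Sym2.mem_mk_left z z⟩)
    linarith
  have hg0 : ∀ ω, 0 ≤ g ω := fun ω => sub_nonneg.2 (hFle _)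
  have hgZ : ∀ ω, ω ∈ Zv → g ω = 0 := by
    intro ω hω
    show M - F (openEdgeCluster ω s) = 0
    rw [hFz _ ((reachable_iff_exists_mem_openEdgeCluster ω s z).1 hω), sub_self]
  -- integrals of `f` versus `g`
  have hfg : ∀ S : Set (BondConfig V), ∫ ω in S, f ω ∂μ = M * μ.real S - ∫ ω in S, g ω ∂μ := by
    intro S
    have : (fun ω => f ω) = fun ω => M - g ω := by funext ω; simp [hg]
    rw [this, integral_sub Integrable.of_finite Integrable.of_finite, setIntegral_const, smul_eq_mul, mul_comm]
  set J := ∫ ω in D, g ω ∂μ with hJ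
  have hJ0 : 0 ≤ J := setIntegral_nonneg (hmeas D) fun ω _ => hg0 ω
  -- `∫_{D ∩ Y} g ≥ 0` and `∫_{D ∩ Z} g = 0`
  have hIY : 0 ≤ ∫ ω in D ∩ Yv, g ω ∂μ := setIntegral_nonneg (hmeas _) fun ω _ => hg0 ω
  have hIZ : ∫ ω in D ∩ Zv, g ω ∂μ = 0 := setIntegral_eq_zero_of_forall_eq_zero fun ω hω => hgZ ω hω.2
  -- the brackets are shift/sign invariant
  have hbY : μ.real D * (∫ ω in D ∩ Yv, f ω ∂μ) - (∫ ω in D, f ω ∂μ) * μ.real (D ∩ Yv) =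
      -(μ.real D * (∫ ω in D ∩ Yv, g ω ∂μ) - J * μ.real (D ∩ Yv)) := by
    rw [hfg (D ∩ Yv), hfg D]; ring
  have hbZ : μ.real D * (∫ ω in D ∩ Zv, f ω ∂μ) - (∫ ω in D, f ω ∂μ) * μ.real (D ∩ Zv) = J * μ.real (D ∩ Zv) := by
    rw [hfg (D ∩ Zv), hfg D, hIZ]; ring
  change μ.real TW * (μ.real D * (∫ ω in D ∩ Yv, f ω ∂μ) - (∫ ω in D, f ω ∂μ) * μ.real (D ∩ Yv)) ≤
    μ.real T * (μ.real D * (∫ ω in D ∩ Zv, f ω ∂μ) - (∫ ω in D, f ω ∂μ) * μ.real (D ∩ Zv))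
  rw [hbY, hbZ]
  have key := mdlx_marker_reach_le w s y z X
  change μ.real TW * μ.real (D ∩ Yv) ≤ μ.real T * μ.real (D ∩ Zv) at key
  have hTW0 : 0 ≤ μ.real TW := measureReal_nonneg
  have hD0 : 0 ≤ μ.real D := measureReal_nonneg
  -- left side ≤ μ(TW)·J·μ(D∩Y) ≤ J·μ(T)·μ(D∩Z) = right side
  have h1 : μ.real TW * -(μ.real D * (∫ ω in D ∩ Yv, g ω ∂μ) - J * μ.real (D ∩ Yv)) ≤ μ.real TW * (J * μ.real (D ∩ Yv)) := by
    apply mul_le_mul_of_nonneg_left _ hTW0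
    nlinarith [hIY, hD0]
  have h2 := mul_le_mul_of_nonneg_left key hJ0
  nlinarith [h1, h2]

/-- **Instance: the up-event `{s↔z} ∪ {s↔b}`** (`F = max(1{s↔z}, 1{s↔b})`, every fifth vertex `b`): the `Consts.MDLXJoint` inequality holds at it in
every weighted graph. [cite: VandenbergHaggstromKahn2005, Thm. 1.3 (p. 6)] -/
theorem mdlxJoint_reachUnion (w : Sym2 V → unitInterval) (s y z b : V) (X : Set V) :
    (prodBernoulli w).real ({ω : BondConfig V | ∀ x ∈ insert s X, ¬ (openGraph ω).Reachable y x} ∩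
          {ω | ∀ x ∈ X, ¬ (openGraph ω).Reachable s x} ∩ openConn y z) *
        ((prodBernoulli w).real {ω : BondConfig V | ∀ x ∈ X, ¬ (openGraph ω).Reachable s x} *
            (∫ ω in {ω : BondConfig V | ∀ x ∈ X, ¬ (openGraph ω).Reachable s x} ∩ openConn s y,
              max (connIndicatorFn s z (openEdgeCluster ω s)) (connIndicatorFn s b (openEdgeCluster ω s)) ∂(prodBernoulli w)) -
          (∫ ω in {ω : BondConfig V | ∀ x ∈ X, ¬ (openGraph ω).Reachable s x},
              max (connIndicatorFn s z (openEdgeCluster ω s)) (connIndicatorFn s b (openEdgeCluster ω s)) ∂(prodBernoulli w)) *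
            (prodBernoulli w).real ({ω : BondConfig V | ∀ x ∈ X, ¬ (openGraph ω).Reachable s x} ∩ openConn s y)) ≤
      (prodBernoulli w).real ({ω : BondConfig V | ∀ x ∈ insert s X, ¬ (openGraph ω).Reachable y x} ∩
          {ω | ∀ x ∈ X, ¬ (openGraph ω).Reachable s x}) *
        ((prodBernoulli w).real {ω : BondConfig V | ∀ x ∈ X, ¬ (openGraph ω).Reachable s x} *
            (∫ ω in {ω : BondConfig V | ∀ x ∈ X, ¬ (openGraph ω).Reachable s x} ∩ openConn s z,
              max (connIndicatorFn s z (openEdgeCluster ω s)) (connIndicatorFn s b (openEdgeCluster ω s)) ∂(prodBernoulli w)) -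
          (∫ ω in {ω : BondConfig V | ∀ x ∈ X, ¬ (openGraph ω).Reachable s x},
              max (connIndicatorFn s z (openEdgeCluster ω s)) (connIndicatorFn s b (openEdgeCluster ω s)) ∂(prodBernoulli w)) *
            (prodBernoulli w).real ({ω : BondConfig V | ∀ x ∈ X, ¬ (openGraph ω).Reachable s x} ∩ openConn s z)) := by
  classical
  have hmono : Monotone (fun C : Set (Sym2 V) => max (connIndicatorFn s z C) (connIndicatorFn s b C)) :=
    fun C C' hCC' => max_le_max (monotone_connIndicatorFn s z hCC') (monotone_connIndicatorFn s b hCC')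
  have hsat : ∀ C : Set (Sym2 V), (z = s ∨ ∃ e ∈ C, z ∈ e) → max (connIndicatorFn s z C) (connIndicatorFn s b C) = 1 := by
    intro C hC
    have h1 : connIndicatorFn s z C = 1 := by unfold connIndicatorFn; rw [if_pos hC]
    have h2 : connIndicatorFn s b C ≤ 1 := by unfold connIndicatorFn; split_ifs <;> norm_num
    rw [h1]; exact max_eq_left h2
  exact mdlxJoint_of_eq_on_reach w s y z X _ hmono 1 hsat

end Consts

end Summit.CriticalPhenomena.PercolationContinuityZ3.Theorems

end
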